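import Summits.QuantumFields.YangMills.Theorems.FluctuationComparisonRegPrIntLOrganTangentFibreMeanVersionMW
import Summits.QuantumFields.YangMills.Theorems.FluctuationComparisonRegPrIntLOrganTangentAPackageDescendTo
import Summits.QuantumFields.YangMills.Theorems.FluctuationComparisonRegPrIntLRunpairOrganFibreLawDefs
import Literature.MathematicalPhysics.QuantumFieldTheory.Balaban1983to89.BalabanAdmissibleClassParams
import Literature.MathematicalPhysics.QuantumFieldTheory.Balaban1983to89.T4AveragingDisintegration
import Literature.MathematicalPhysics.QuantumFieldTheory.Balaban1983to89.T4CubeChartExp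
import HarnessLib

/-!
# Route `UnitScaleTilt` — crux `FluctuationComparisonRegPrIntL` (stmt-QuantumFields-20520, rung R3), PATH-B organ: «ORGAN DISCHARGE INPUTS (HJ), NEAR-PAIR «sq» EDITION» — DEFINITIONS
# (sq-programme step (sq3): LEAD `ym-ust-20520-w3` g26 №38 (b) ∕ №40 ∕ №47 (4); ★★OWNER WORD №416 ∕ RULING №78; bytes by the ROW pen ideator `ym-r3-idea-1` g29, filed by LEAD)

Definitions file (route-posited object, `--kind definition --supports stmt-QuantumFields-20520 --as helper`): ONE `def OrganDischargeInputsHJsq : Prop` whose body is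
BYTE-IDENTICAL to the crux workfile `Cruxes/FluctuationComparisonRegPrIntL/DischargeInputsHJsq.lean` (the edition of record; generator `assemble_sq_v01.g29.py`), so that
Theorems-side files (the knit-sq `OrganDischargeInputsHJsq → SpreadFibreLawHJsq`, LEAD w3 g26) can import it.  It is the near-pair edition of `OrganDischargeInputsHJ`
(✓`…RunpairOrganDischargeInputsHJDefs`, body ws16 48cc21582bfc4d20) by FOUR clause substitutions and nothing else: (I-geo)ᵇ ↦ (I-geo)sq (`∃ (c Db : ℝ) (DP : …)`:
`√3·rc ≤ 3∕16`, `c < 1`, `0 ≤ Db`, `DP ≤ Db`, the one-bond displacement clause `hdisp` verbatim, room₃ `24∕25·θBal_Ts + 3·(Db·rc) ≤ c·θBal_Ts` — no `Dw`, no window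
clause `hglobW`: near displacement is DERIVED from `hdisp`, ✓`…OrganTangentNearDisplacement`∕`…NearStability`); (I-law-X) ↦ the adjacent-edge package of
✓`…OrganTangentLawClausesOfILawSq` `l1jSq_of_ilaw` (`U₂` dropped, law edge `V₁ → W₂ = V₁^{B′,m′}`); (I-law-V3) ↦ `jv3Sq_of_ilaw`'s (same restriction); (I-cov) ↦ (I-cov)sq
(law-point-relative profiles `Prof Y`, consumed by ✓`…OrganTangentCovSandwichSq`); prefix ∕ letters ∕ chart [0]–[11] ∕ seed binders ∕ (I-curv) ∕ (I-law-L) ∕ (I-law-V4)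
unchanged.

WHAT THIS IS ∕ IS NOT.  A HYPOTHESIS ROW (NOT printed as a theorem) — EXACTLY AS OPEN as `SpreadFibreLawHJsq`, and a pure weakening ∕ re-profiling of
`OrganDischargeInputsHJ`; `hdisp`, (Lip)(Diff₀), the kernels, the curvature and chart letters are what a discharger must PROVE from [Balaban1985Variational] Thm 1 p.279 ∕
Prop 9 p.309, [Balaban1985Averaging] (9)–(13) p.19, [Balaban1987RG1] Thm 1 p.259 ∕ Thm 3 p.264 — SOURCES of the shapes only; NOTHING of these is asserted or proved here.
`SpreadFibreLawH(J)` ∕ `SpreadFibreLawHJsq` ∕ both ROW-2 editions UNDISCHARGED; crux 20520, the five registered stubs of `Lines/semiclassical_s2beta.lean`, O1ᵘ-H and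
`YM3TorusSU2` are NOT proved by anything in this file; rung R3 = SU(2) YM₃ on T³ at fixed lattice data — NOT d = 4, NOT infinite volume, NOT a mass gap, NOT Clay.

No `theorem`, no `instance`, no `notation`, no attribute changes; imports = `OrganDischargeInputsHJ`'s DEFS file's.
-/

set_option autoImplicit false

noncomputable section

namespace Summit.QuantumFields.YangMills.Theorems.FluctuationComparisonRegPrIntLRunpairOrganDischargeInputsHJsq

open MeasureTheory Filter Topology Function
open Set (Icc)
open scoped ENNReal NNReal BigOperators
open Literature.MathematicalPhysics.QuantumFieldTheory.Balaban1983to89 T3ContinuumYM3Torus T3NestedUnitLaws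
  T3UnitLawDensityEML T4Continuum BalabanUVClass T3UnitScaleTilt T3LevelShift T3TiltDescent
open T4CubeChartExp (expPt)
open Summit.QuantumFields.YangMills.Theorems.FluctuationComparisonRegPrIntLRunpairOrganFibreLaw (mwCut wNum wgt)

/-- «ORGAN DISCHARGE INPUTS (HJ)», NEAR-PAIR «sq» EDITION v0.1 — «b»'s prefix∕chart [0]–[11] and seed binders verbatim; per stride (I-geo)sq (`c Db DP`:
`√3·rc ≤ 3∕16`, `c < 1`, `0 ≤ Db`, `DP ≤ Db`, one-bond displacement `hdisp`, room₃ `24∕25·θBal_Ts + 3·(Db·rc) ≤ c·θBal_Ts` — no `Dw`, no `hglobW`), (I-curv)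
verbatim, (I-law) with the adjacent-edge packages `kX`∕`kV₃` of (L33) and `kL`∕`kV₄` unchanged, (I-cov)sq with law-point profiles.  A HYPOTHESIS ROW exactly as
open as `SpreadFibreLawHJsq`; shapes after [Balaban1985Variational] Thm 1∕Prop 9, [Balaban1985Averaging] (9)–(13), [Balaban1987RG1] Thm 1∕Thm 3 — SOURCES only,
nothing asserted. -/
def OrganDischargeInputsHJsq : Prop :=
  ∃ pW : ℝ, ∃ γ₁ : ℝ, 0 < γ₁ ∧ ∀ (F : T3Family) (γ : ℝ), 0 < γ → γ ≤ γ₁ → ∀ (b₀ p₀ : ℝ) (j₀ : ℕ) (prm : ℕ → ClassParams) (η : ℕ → ℝ) (rA : ℝ) (Bρ : ℕ → ℝ), 0 < b₀ → 0 < p₀ → pW ≤ p₀ → AdmissibleClassParams F γ b₀ p₀ prm → (∀ j, 0 ≤ η j) → Summable η → Summable (fun i => ∑' k, η (k + i)) → Tendsto (fun j => (∑' k, η (k + j)) * ((1 + 2 * ((F.L : ℝ) ^ j / γ) * (Fintype.card (Plaq (F.P j) 0) : ℝ)) * (Fintype.card (PBond (F.P j) 0) : ℝ) ^ 2)) atTop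 (𝓝 0) → 0 < rA → ∃ κ₀ : ℝ, 0 < κ₀ ∧ ∀ (κ : ℝ), 0 < κ → κ ≤ κ₀ → ∃ (rc w₀ NT NX NL CJ NV1 NV2 NV3 NV4 : ℝ) (δT δX δL δV1 δV2 δV3 δV4 : ℕ → ℝ) (j₁ : ℕ), 0 < rc ∧ 0 < w₀ ∧ 0 ≤ NT ∧ 0 ≤ NX ∧ 0 ≤ NL ∧ 0 ≤ CJ ∧ (∀ n, 0 ≤ δT n ∧ 0 ≤ δX n ∧ 0 ≤ δL n) ∧ Summable δT ∧ Summable (fun i => ∑' k, δT (k + i)) ∧ Tendsto (fun j => (∑' k, δT (k + j)) * ((1 + 2 * ((F.L : ℝ) ^ j / γ) * (Fintype.card (Plaq (F.P j) 0) : ℝ)) * (Fintype.card (PBond (F.P j) 0) : ℝ) ^ 2)) atTop (𝓝 0) ∧ Summable δX ∧ Summable (fun i => ∑' k, δX (k + i)) ∧ Tendsto (fun j => (∑' k, δX (k + j)) * ((1 + 2 * ((F.L : ℝ) ^ j / γ) * (Fintype.card (Plaq (F.P j) 0) : ℝ)) * (Fintype.card (PBond (F.P j) 0) : ℝ) ^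 2)) atTop (𝓝 0) ∧ Summable δL ∧ Summable (fun i => ∑' k, δL (k + i)) ∧ Tendsto (fun j => (∑' k, δL (k + j)) * ((1 + 2 * ((F.L : ℝ) ^ j / γ) * (Fintype.card (Plaq (F.P j) 0) : ℝ)) * (Fintype.card (PBond (F.P j) 0) : ℝ) ^ 2)) atTop (𝓝 0) ∧ (0 ≤ NV1 ∧ 0 ≤ NV2 ∧ 0 ≤ NV3 ∧ 0 ≤ NV4 ∧ (∀ n, 0 ≤ δV1 n ∧ 0 ≤ δV2 n ∧ 0 ≤ δV3 n ∧ 0 ≤ δV4 n) ∧ (Summable δV1 ∧ Summable (fun i => ∑' k, δV1 (k + i)) ∧ Tendsto (fun j => (∑' k, δV1 (k + j)) * ((1 + 2 * ((F.L : ℝ) ^ j / γ) * (Fintype.card (Plaq (F.P j) 0) : ℝ)) * (Fintype.card (PBond (F.P j) 0) : ℝ) ^ 2)) atTop (𝓝 0)) ∧ (Summable δV2 ∧ Summable (fun i => ∑' k, δV2 (k + i)) ∧ Tendsto (fun j => (∑' k, δV2 (k + j)) * ((1 + 2 * ((F.L : ℝ) ^ j / γ) * (Fintype.card (Plaq (F.P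 j) 0) : ℝ)) * (Fintype.card (PBond (F.P j) 0) : ℝ) ^ 2)) atTop (𝓝 0)) ∧ (Summable δV3 ∧ Summable (fun i => ∑' k, δV3 (k + i)) ∧ Tendsto (fun j => (∑' k, δV3 (k + j)) * ((1 + 2 * ((F.L : ℝ) ^ j / γ) * (Fintype.card (Plaq (F.P j) 0) : ℝ)) * (Fintype.card (PBond (F.P j) 0) : ℝ) ^ 2)) atTop (𝓝 0)) ∧ (Summable δV4 ∧ Summable (fun i => ∑' k, δV4 (k + i)) ∧ Tendsto (fun j => (∑' k, δV4 (k + j)) * ((1 + 2 * ((F.L : ℝ) ^ j / γ) * (Fintype.card (Plaq (F.P j) 0) : ℝ)) * (Fintype.card (PBond (F.P j) 0) : ℝ) ^ 2)) atTop (𝓝 0))) ∧ j₀ ≤ j₁ ∧ ∀ (ν : ℕ → (j : ℕ) → MeasureTheory.Measure (GaugeField (F.P j) 0 ↥(Matrix.specialUnitaryGroup (Fin 2) ℂ))), (∀ K, ν K K = T4GenFunBounds.gibbsMeasure (F.P K) ((F.scheme ℰp γ).β K)) → (∀ K j, j < K → ν K j = Measure.map (descend F ℰp j) (ν K (j + 1)))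 → ∀ (K K' : ℕ), K ≤ K' → ∀ (Ts T : ℕ), Ts < T → T ≤ K → ∀ (μ μ' : ((j : ℕ) → MeasureTheory.Measure (GaugeField (F.P j) 0 ↥(Matrix.specialUnitaryGroup (Fin 2) ℂ)))) (ρ ρ' : ((j : ℕ) → GaugeField (F.P j) 0 ↥(Matrix.specialUnitaryGroup (Fin 2) ℂ) → ℝ)), (∀ j : ℕ, Ts ≤ j → j ≤ T → μ j = ν K j ∧ μ' j = ν K' j) → (∀ j : ℕ, j < Ts → μ j = Measure.map (descend F ℰp j) ((μ (j + 1)).withDensity (fun U => ENNReal.ofReal ((∏ p : Plaq _ _, max 0 (min 1 ((24 / 25 * (θBal F.L γ b₀ p₀ (j + 1)) - dist1 (GaugeField.plaqHol U p)) / ((24 / 25 - 1 / 2) * (θBal F.L γ b₀ p₀ (j + 1))))))))) ∧ μ' j = Measure.map (descend F ℰp j) ((μ' (j + 1)).withDensity (fun U => ENNReal.ofReal ((∏ p : Plaq _ _, max 0 (min 1 ((24 / 25 * (θBal F.L γ b₀ p₀ (j + 1)) - dist1 (GaugeField.plaqHol U p)) / ((24 / 25 - 1 / 2) * (θBal F.L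 γ b₀ p₀ (j + 1)))))))))) → (∀ j : ℕ, Ts ≤ j → j < T → μ j = Measure.map (descend F ℰp j) (μ (j + 1)) ∧ μ' j = Measure.map (descend F ℰp j) (μ' (j + 1))) → (∀ j : ℕ, j ≤ T → IsFiniteMeasure (μ j) ∧ IsFiniteMeasure (μ' j)) → (∀ j : ℕ, j₀ ≤ j → j ≤ T → ((∀ U, PlaqSmall (θBal F.L γ b₀ p₀ j) U → 0 < ρ j U ∧ 0 < ρ' j U) ∧ μ j = (fieldMeasure _ _ _).withDensity (fun U => ENNReal.ofReal (ρ j U)) ∧ μ' j = (fieldMeasure _ _ _).withDensity (fun U => ENNReal.ofReal (ρ' j U)) ∧ (∃ κ : ℝ, MemAtHeight F ℰp j (prm j) (fun U => Real.exp κ * ρ j U)) ∧ (∃ κ : ℝ, MemAtHeight F ℰp j (prm j) (fun U => Real.exp κ * ρ' j U)) ∧ μ j {U | ¬ PlaqSmall (θBal F.L γ b₀ p₀ j) U} ≤ ENNReal.ofReal (η j) ∧ μ' j {U | ¬ PlaqSmall (θBal F.L γ b₀ p₀ j) U} ≤ ENNReal.ofReal (η j) ∧ (ContinuousOn (ρ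 j) {U | PlaqSmall (θBal F.L γ b₀ p₀ j) U} ∧ ContinuousOn (ρ' j) {U | PlaqSmall (θBal F.L γ b₀ p₀ j) U}) ∧ ((∀ (U : GaugeField _ _ ↥(Matrix.specialUnitaryGroup (Fin 2) ℂ)), PlaqSmall (49 / 50 * θBal F.L γ b₀ p₀ j) U → ∀ (b b' : PBond _ _) (v v' : Fin 3 → ℝ), ‖v‖ ≤ 1 → ‖v'‖ ≤ 1 → ∃ g : ℂ × ℂ → ℂ, DifferentiableOn ℂ g (Metric.ball (0 : ℂ) (rA * (49 / 50 * θBal F.L γ b₀ p₀ j)) ×ˢ Metric.ball (0 : ℂ) (rA * (49 / 50 * θBal F.L γ b₀ p₀ j))) ∧ (∀ (s t : ℝ) (V Z : GaugeField _ _ ↥(Matrix.specialUnitaryGroup (Fin 2) ℂ)), |s| < rA * (49 / 50 * θBal F.L γ b₀ p₀ j) → |t| < rA * (49 / 50 * θBal F.L γ b₀ p₀ j) → (∀ e, e ≠ b → V e = U e) → V b = U b * expPt (s • v) → (∀ e, e ≠ b' → Z e = V e) → Z b' = V b' * expPt (t • v') → g ((s : ℂ), (t : ℂ)) = (((Real.log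 (ρ j Z)) : ℝ) : ℂ)) ∧ ∀ z ∈ Metric.ball (0 : ℂ) (rA * (49 / 50 * θBal F.L γ b₀ p₀ j)) ×ˢ Metric.ball (0 : ℂ) (rA * (49 / 50 * θBal F.L γ b₀ p₀ j)), ‖g z - g 0‖ ≤ (Bρ j)) ∧ (∀ (U : GaugeField _ _ ↥(Matrix.specialUnitaryGroup (Fin 2) ℂ)), PlaqSmall (49 / 50 * θBal F.L γ b₀ p₀ j) U → ∀ (b b' : PBond _ _) (v v' : Fin 3 → ℝ), ‖v‖ ≤ 1 → ‖v'‖ ≤ 1 → ∃ g : ℂ × ℂ → ℂ, DifferentiableOn ℂ g (Metric.ball (0 : ℂ) (rA * (49 / 50 * θBal F.L γ b₀ p₀ j)) ×ˢ Metric.ball (0 : ℂ) (rA * (49 / 50 * θBal F.L γ b₀ p₀ j))) ∧ (∀ (s t : ℝ) (V Z : GaugeField _ _ ↥(Matrix.specialUnitaryGroup (Fin 2) ℂ)), |s| < rA * (49 / 50 * θBal F.L γ b₀ p₀ j) → |t| < rA * (49 / 50 * θBal F.L γ b₀ p₀ j) → (∀ e, e ≠ b → V e = U e) → V b = U b * expPt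 (s • v) → (∀ e, e ≠ b' → Z e = V e) → Z b' = V b' * expPt (t • v') → g ((s : ℂ), (t : ℂ)) = (((Real.log (ρ' j Z)) : ℝ) : ℂ)) ∧ ∀ z ∈ Metric.ball (0 : ℂ) (rA * (49 / 50 * θBal F.L γ b₀ p₀ j)) ×ˢ Metric.ball (0 : ℂ) (rA * (49 / 50 * θBal F.L γ b₀ p₀ j)), ‖g z - g 0‖ ≤ (Bρ j))))) → ∀ (j : ℕ), j₁ ≤ j → ∀ (hjTs : j + 1 ≤ Ts), ∃ (Z : Type) (_ : MeasurableSpace Z) (τ : MeasureTheory.Measure Z) (Φ : GaugeField (F.P j) 0 ↥(Matrix.specialUnitaryGroup (Fin 2) ℂ) × Z → GaugeField (F.P Ts) 0 ↥(Matrix.specialUnitaryGroup (Fin 2) ℂ)) (J : GaugeField (F.P j) 0 ↥(Matrix.specialUnitaryGroup (Fin 2) ℂ) × Z → NNReal) (S : Set (GaugeField (F.P Ts) 0 ↥(Matrix.specialUnitaryGroup (Fin 2) ℂ))) (π : Site (F.P Ts) 0 → Site (F.P j) 0), MeasureTheory.IsProbabilityMeasure τ ∧ Measurable Φ ∧ Measurable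 J ∧ MeasurableSet S ∧ (∀ U : GaugeField (F.P Ts) 0 ↥(Matrix.specialUnitaryGroup (Fin 2) ℂ), (∀ (n : ℕ) (hjn : j + 1 ≤ n) (hnK : n ≤ Ts), PlaqSmall (24 / 25 * θBal F.L γ b₀ p₀ n) (descendTo F ℰp n Ts hnK U)) → U ∈ S) ∧ (∀ V z, descendTo F ℰp j Ts (Nat.le_of_succ_le hjTs) (Φ (V, z)) = V) ∧ (∀ A : Set (GaugeField (F.P j) 0 ↥(Matrix.specialUnitaryGroup (Fin 2) ℂ)), MeasurableSet A → (fieldMeasure (F.P Ts) 0 ↥(Matrix.specialUnitaryGroup (Fin 2) ℂ)).restrict (descendTo F ℰp j Ts (Nat.le_of_succ_le hjTs) ⁻¹' A ∩ S) = ((((fieldMeasure (F.P j) 0 ↥(Matrix.specialUnitaryGroup (Fin 2) ℂ)).restrict A).prod τ).withDensity (fun p => (J p : ENNReal))).map Φ) ∧ (∀ f : GaugeField (F.P Ts) 0 ↥(Matrix.specialUnitaryGroup (Fin 2) ℂ) → ℝ, Continuous f → (∀ U, f U ≠ 0 → (∀ (n : ℕ) (hjn : j + 1 ≤ n) (hnK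 : n ≤ Ts), PlaqSmall (24 / 25 * θBal F.L γ b₀ p₀ n) (descendTo F ℰp n Ts hnK U))) → ∀ z, ContinuousOn (fun V => (J (V, z) : ℝ) * f (Φ (V, z))) {V | PlaqSmall (θBal F.L γ b₀ p₀ j) V}) ∧ (∀ V z, (J (V, z) : ℝ) ≤ CJ) ∧ (∀ V, PlaqSmall (θBal F.L γ b₀ p₀ j) V → 0 < ∫⁻ z in {z | (∀ (n : ℕ) (hjn : j + 1 ≤ n) (hnK : n ≤ Ts), PlaqSmall (24 / 25 * θBal F.L γ b₀ p₀ n) (descendTo F ℰp n Ts hnK (Φ (V, z))))}, (J (V, z) : ENNReal) ∂τ) ∧ (∀ x y : Site (F.P Ts) 0, (((π x).tdist (π y) : ℕ) : ℝ) ≤ ((x.tdist y : ℕ) : ℝ)) ∧ (∀ y : Site (F.P j) 0, ∃ s : Finset (Site (F.P Ts) 0), (∀ x, π x = y → x ∈ s) ∧ (s.card : ℝ) ≤ ((F.L : ℝ) ^ (Ts - j)) ^ 3) ∧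
    (∃ (c Db : ℝ) (DP : Plaq (F.P Ts) 0 → PBond (F.P j) 0 → ℝ), Real.sqrt 3 * rc ≤ 3 / 16 ∧ c < 1 ∧ 0 ≤ Db ∧ (∀ p b, DP p b ≤ Db) ∧
      (∀ (z : Z) (X : GaugeField (F.P j) 0 ↥(Matrix.specialUnitaryGroup (Fin 2) ℂ)), PlaqSmall (θBal F.L γ b₀ p₀ j) X →
      ∀ (b : PBond (F.P j) 0) (v : Fin 3 → ℝ), ‖v‖ ≤ rc * (θBal F.L γ b₀ p₀ j / 4) → ∀ s ∈ Icc (0 : ℝ) 1, ∀ p : Plaq (F.P Ts) 0,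
        dist1 (GaugeField.plaqHol (Φ (update X b (X b * expPt (s • v)), z)) p)
          ≤ dist1 (GaugeField.plaqHol (Φ (X, z)) p) + DP p b * (‖v‖ / (θBal F.L γ b₀ p₀ j / 4))) ∧
      24 / 25 * θBal F.L γ b₀ p₀ Ts + 3 * (Db * rc) ≤ c * θBal F.L γ b₀ p₀ Ts) ∧
    (∀ (k : PBond (F.P Ts) 0 → PBond (F.P Ts) 0 → ℝ) (w : ℝ), 0 ≤ w → w / (((F.L : ℝ) ^ Ts / γ) * θBal F.L γ b₀ p₀ Ts ^ 2) ≤ w₀ → (∀ b b', 0 ≤ k b b') → (∀ b, ∑ b', k b b' * Real.exp (κ * (b.src.tdist b'.src : ℝ)) ≤ w) → (∀ (b b' : PBond (F.P Ts) 0) (v v' : Fin 3 → ℝ) (U V W Y : GaugeField (F.P Ts) 0 ↥(Matrix.specialUnitaryGroup (Fin 2) ℂ)), ‖v‖ ≤ (rA / 2) * (θBal F.L γ b₀ p₀ Ts / 4) → ‖v'‖ ≤ (rA / 2) * (θBal F.L γ b₀ p₀ Ts / 4) → PlaqSmall (θBal F.L γ b₀ p₀ Ts / 4) U → PlaqSmall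 (θBal F.L γ b₀ p₀ Ts / 4) V → PlaqSmall (θBal F.L γ b₀ p₀ Ts / 4) W → PlaqSmall (θBal F.L γ b₀ p₀ Ts / 4) Y → (∀ e, e ≠ b → V e = U e) → V b = U b * expPt v → (∀ e, e ≠ b' → W e = U e) → W b' = U b' * expPt v' → (∀ e, e ≠ b' → Y e = V e) → Y b' = V b' * expPt v' → |(Real.log (ρ Ts Y) - Real.log (ρ' Ts Y)) - (Real.log (ρ Ts V) - Real.log (ρ' Ts V)) - (Real.log (ρ Ts W) - Real.log (ρ' Ts W)) + (Real.log (ρ Ts U) - Real.log (ρ' Ts U))| ≤ k b b' * (‖v‖ / (θBal F.L γ b₀ p₀ Ts / 4)) * (‖v'‖ / (θBal F.L γ b₀ p₀ Ts / 4))) → 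
    (∃ (kP : Plaq (F.P Ts) 0 → Plaq (F.P Ts) 0 → ℝ) (gP : Plaq (F.P Ts) 0 → ℝ) (KP : Plaq (F.P Ts) 0 → PBond (F.P j) 0 → ℝ) (KP2 : Plaq (F.P Ts) 0 → PBond (F.P j) 0 → PBond (F.P j) 0 → ℝ),
      (∀ p q, 0 ≤ kP p q) ∧ (∀ p, 0 ≤ gP p) ∧ (∀ p b, 0 ≤ KP p b) ∧ (∀ p b b', 0 ≤ KP2 p b b') ∧
      (∀ t : ℝ, 0 ≤ t → t ≤ 1 →
        ∃ (kB : PBond (F.P j) 0 → PBond (F.P j) 0 → ℝ) (ES : ℝ), (∀ B B', 0 ≤ kB B B') ∧ 0 ≤ ES ∧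
        (∀ B, ∑ B', ((∑ p, ∑ q, KP p B * kP p q * KP q B' + ∑ p, gP p * KP2 p B B') + ES * kB B B') * Real.exp (κ * (B.src.tdist B'.src : ℝ)) ≤ NT * ((((F.L : ℝ) ^ j / γ) * θBal F.L γ b₀ p₀ j ^ 2) / (((F.L : ℝ) ^ Ts / γ) * θBal F.L γ b₀ p₀ Ts ^ 2)) * w + δT j * (((F.L : ℝ) ^ j / γ) * θBal F.L γ b₀ p₀ j ^ 2)) ∧
        (∀ (Xw : GaugeField (F.P j) 0 ↥(Matrix.specialUnitaryGroup (Fin 2) ℂ)), PlaqSmall (θBal F.L γ b₀ p₀ j / 4) Xw →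
          ∃ Good : Set Z, MeasurableSet Good ∧ (∫ z in Goodᶜ, wgt F γ b₀ p₀ j Ts ρ ρ' τ Φ J t Xw z ∂τ ≤ ES) ∧
          (∀ z ∈ Good, wgt F γ b₀ p₀ j Ts ρ ρ' τ Φ J t Xw z ≠ 0 →
      ∀ (b b' : PBond (F.P j) 0) (v v' : Fin 3 → ℝ) (X : GaugeField (F.P j) 0 ↥(Matrix.specialUnitaryGroup (Fin 2) ℂ)),
      ‖v‖ ≤ rc * (θBal F.L γ b₀ p₀ j / 4) → ‖v'‖ ≤ rc * (θBal F.L γ b₀ p₀ j / 4) → PlaqSmall (θBal F.L γ b₀ p₀ j / 4) X →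
      PlaqSmall (θBal F.L γ b₀ p₀ j / 4) (update X b (X b * expPt v)) → PlaqSmall (θBal F.L γ b₀ p₀ j / 4) (update X b' (X b' * expPt v')) →
      PlaqSmall (θBal F.L γ b₀ p₀ j / 4) (update (update X b (X b * expPt v)) b' ((update X b (X b * expPt v)) b' * expPt v')) →
      ∃ (F₂ F₁₂ : ℝ → ℝ → ℝ) (α α' γ' : Plaq (F.P Ts) 0 → ℝ → ℝ → ℝ),
        (∀ t' ∈ Icc (0 : ℝ) 1, HasDerivWithinAt
          (fun t' => (fun X' => Real.log (ρ Ts (Φ (X', z))) - Real.log (ρ' Ts (Φ (X', z))))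
            (update (update X b (X b * expPt ((0 : ℝ) • v))) b' ((update X b (X b * expPt ((0 : ℝ) • v))) b' * expPt (t' • v'))))
          (F₂ 0 t') (Icc 0 1) t') ∧
        (∀ t' ∈ Icc (0 : ℝ) 1, HasDerivWithinAt
          (fun t' => (fun X' => Real.log (ρ Ts (Φ (X', z))) - Real.log (ρ' Ts (Φ (X', z))))
            (update (update X b (X b * expPt ((1 : ℝ) • v))) b' ((update X b (X b * expPt ((1 : ℝ) • v))) b' * expPt (t' • v'))))
          (F₂ 1 t') (Icc 0 1) t') ∧
        (∀ t' ∈ Icc (0 : ℝ) 1, ∀ s ∈ Icc (0 : ℝ) 1, HasDerivWithinAt (fun s => F₂ s t') (F₁₂ s t') (Icc 0 1) s) ∧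
        (∀ p, ∀ s ∈ Icc (0 : ℝ) 1, ∀ t' ∈ Icc (0 : ℝ) 1, 0 ≤ α p s t' ∧ α p s t' ≤ KP p b * (‖v‖ / (θBal F.L γ b₀ p₀ j / 4))) ∧
        (∀ q, ∀ s ∈ Icc (0 : ℝ) 1, ∀ t' ∈ Icc (0 : ℝ) 1, 0 ≤ α' q s t' ∧ α' q s t' ≤ KP q b' * (‖v'‖ / (θBal F.L γ b₀ p₀ j / 4))) ∧
        (∀ p, ∀ s ∈ Icc (0 : ℝ) 1, ∀ t' ∈ Icc (0 : ℝ) 1,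
          0 ≤ γ' p s t' ∧ γ' p s t' ≤ KP2 p b b' * (‖v‖ / (θBal F.L γ b₀ p₀ j / 4)) * (‖v'‖ / (θBal F.L γ b₀ p₀ j / 4))) ∧
        (∀ s ∈ Icc (0 : ℝ) 1, ∀ t' ∈ Icc (0 : ℝ) 1,
          |F₁₂ s t'| ≤ ∑ p, ∑ q, α p s t' * kP p q * α' q s t' + ∑ p, gP p * γ' p s t')) ∧
          (∀ (B B' : PBond (F.P j) 0) (m m' : Fin 3 → ℝ) (U V W Y : GaugeField (F.P j) 0 ↥(Matrix.specialUnitaryGroup (Fin 2) ℂ)), ‖m‖ ≤ rc * (θBal F.L γ b₀ p₀ j / 4) → ‖m'‖ ≤ rc * (θBal F.L γ b₀ p₀ j / 4) → PlaqSmall (θBal F.L γ b₀ p₀ j / 4) U → PlaqSmall (θBal F.L γ b₀ p₀ j / 4) V → PlaqSmall (θBal F.L γ b₀ p₀ j / 4) W → PlaqSmall (θBal F.L γ b₀ p₀ j / 4) Y → (∀ e, e ≠ B → V e = U e) → V B = U B * expPt m → (∀ e, e ≠ B' → W e = U e) → W B' = U B' * expPt m' → (∀ e, e ≠ B' → Y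 e = V e) → Y B' = V B' * expPt m' →
          ∀ z, wgt F γ b₀ p₀ j Ts ρ ρ' τ Φ J t Xw z ≠ 0 →
      |(Real.log (ρ Ts (Φ (Y, z))) - Real.log (ρ' Ts (Φ (Y, z)))) - (Real.log (ρ Ts (Φ (V, z))) - Real.log (ρ' Ts (Φ (V, z))))
        - (Real.log (ρ Ts (Φ (W, z))) - Real.log (ρ' Ts (Φ (W, z)))) + (Real.log (ρ Ts (Φ (U, z))) - Real.log (ρ' Ts (Φ (U, z))))|
        ≤ kB B B' * (‖m‖ / (θBal F.L γ b₀ p₀ j / 4)) * (‖m'‖ / (θBal F.L γ b₀ p₀ j / 4)))))) ∧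
    (∀ t : ℝ, 0 ≤ t → t ≤ 1 →
      (∃ kX : PBond (F.P j) 0 → PBond (F.P j) 0 → ℝ, (∀ B B', 0 ≤ kX B B') ∧ (∀ B, ∑ B', kX B B' * Real.exp (κ * (B.src.tdist B'.src : ℝ)) ≤ NX * ((((F.L : ℝ) ^ j / γ) * θBal F.L γ b₀ p₀ j ^ 2) / (((F.L : ℝ) ^ Ts / γ) * θBal F.L γ b₀ p₀ Ts ^ 2)) * w + δX j * (((F.L : ℝ) ^ j / γ) * θBal F.L γ b₀ p₀ j ^ 2)) ∧ (∀ B', ∑ B, kX B B' * Real.exp (κ * (B.src.tdist B'.src : ℝ)) ≤ NX * ((((F.L : ℝ) ^ j / γ) * θBal F.L γ b₀ p₀ j ^ 2) / (((F.L : ℝ) ^ Ts / γ) * θBal F.L γ b₀ p₀ Ts ^ 2)) * w + δX j * (((F.L : ℝ) ^ j / γ) * θBal F.L γ b₀ p₀ j ^ 2)) ∧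
      (∀ (B B' : PBond (F.P j) 0) (m m' : Fin 3 → ℝ) (U₁ V₁ W₂ : GaugeField (F.P j) 0 ↥(Matrix.specialUnitaryGroup (Fin 2) ℂ)), ‖m‖ ≤ rc * (θBal F.L γ b₀ p₀ j / 4) → ‖m'‖ ≤ rc * (θBal F.L γ b₀ p₀ j / 4) → PlaqSmall (θBal F.L γ b₀ p₀ j / 4) U₁ → PlaqSmall (θBal F.L γ b₀ p₀ j / 4) V₁ → PlaqSmall (θBal F.L γ b₀ p₀ j / 4) W₂ → (∀ e, e ≠ B → V₁ e = U₁ e) → V₁ B = U₁ B * expPt m → (∀ e, e ≠ B' → W₂ e = V₁ e) → W₂ B' = V₁ B' * expPt m' → ∀ (X : ℝ → GaugeField (F.P j) 0 ↥(Matrix.specialUnitaryGroup (Fin 2) ℂ)), (∀ s e, e ≠ B' → X s e = V₁ e) → (∀ s, X s B' = V₁ B' * expPt (s • m')) →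
          ∃ (wN' : ℝ → Z → ℝ) (b bΔ : Z → ℝ), Integrable b τ ∧ Integrable bΔ τ ∧ (∀ s, AEStronglyMeasurable (wN' s) τ) ∧
            (∀ᵐ z ∂τ, LipschitzOnWith (Real.nnabs (b z)) (fun s => wNum F γ b₀ p₀ j Ts ρ ρ' Φ J t (X s) z) (Set.Ioo (-1) 2)) ∧
            (∀ᵐ z ∂τ, LipschitzOnWith (Real.nnabs (bΔ z)) (fun s => ((Real.log (ρ Ts (Φ (V₁, z))) - Real.log (ρ' Ts (Φ (V₁, z)))) - (Real.log (ρ Ts (Φ (U₁, z))) - Real.log (ρ' Ts (Φ (U₁, z))))) * wNum F γ b₀ p₀ j Ts ρ ρ' Φ J t (X s) z) (Set.Ioo (-1) 2)) ∧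
            (∀ s ∈ Set.Icc (0:ℝ) 1, ∀ᵐ z ∂τ, HasDerivAt (fun s => wNum F γ b₀ p₀ j Ts ρ ρ' Φ J t (X s) z) (wN' s z) s) ∧
            (∀ s ∈ Set.Icc (0:ℝ) 1, |(∫ z, ((Real.log (ρ Ts (Φ (V₁, z))) - Real.log (ρ' Ts (Φ (V₁, z)))) - (Real.log (ρ Ts (Φ (U₁, z))) - Real.log (ρ' Ts (Φ (U₁, z))))) * (wN' s z / wNum F γ b₀ p₀ j Ts ρ ρ' Φ J t (X s) z) * (wNum F γ b₀ p₀ j Ts ρ ρ' Φ J t (X s) z / ∫ z', wNum F γ b₀ p₀ j Ts ρ ρ' Φ J t (X s) z' ∂τ) ∂τ)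
                - (∫ z, ((Real.log (ρ Ts (Φ (V₁, z))) - Real.log (ρ' Ts (Φ (V₁, z)))) - (Real.log (ρ Ts (Φ (U₁, z))) - Real.log (ρ' Ts (Φ (U₁, z))))) * (wNum F γ b₀ p₀ j Ts ρ ρ' Φ J t (X s) z / ∫ z', wNum F γ b₀ p₀ j Ts ρ ρ' Φ J t (X s) z' ∂τ) ∂τ) * (∫ z, (wN' s z / wNum F γ b₀ p₀ j Ts ρ ρ' Φ J t (X s) z) * (wNum F γ b₀ p₀ j Ts ρ ρ' Φ J t (X s) z / ∫ z', wNum F γ b₀ p₀ j Ts ρ ρ' Φ J t (X s) z' ∂τ) ∂τ)| ≤ kX B B' * (‖m‖ / (θBal F.L γ b₀ p₀ j / 4)) * (‖m'‖ / (θBal F.L γ b₀ p₀ j / 4))))) ∧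
      (∃ kL : PBond (F.P j) 0 → PBond (F.P j) 0 → ℝ, (∀ B B', 0 ≤ kL B B') ∧ (∀ B, ∑ B', kL B B' * Real.exp (κ * (B.src.tdist B'.src : ℝ)) ≤ NL * ((((F.L : ℝ) ^ j / γ) * θBal F.L γ b₀ p₀ j ^ 2) / (((F.L : ℝ) ^ Ts / γ) * θBal F.L γ b₀ p₀ Ts ^ 2)) * w + δL j * (((F.L : ℝ) ^ j / γ) * θBal F.L γ b₀ p₀ j ^ 2)) ∧
      (∀ (B B' : PBond (F.P j) 0) (m m' : Fin 3 → ℝ) (V00 V10 V01 V11 : GaugeField (F.P j) 0 ↥(Matrix.specialUnitaryGroup (Fin 2) ℂ)), ‖m‖ ≤ rc * (θBal F.L γ b₀ p₀ j / 4) → ‖m'‖ ≤ rc * (θBal F.L γ b₀ p₀ j / 4) → PlaqSmall (θBal F.L γ b₀ p₀ j / 4) V00 → PlaqSmall (θBal F.L γ b₀ p₀ j / 4) V10 → PlaqSmall (θBal F.L γ b₀ p₀ j / 4) V01 → PlaqSmall (θBal F.L γ b₀ p₀ j / 4) V11 → (∀ e, e ≠ B → V10 e = V00 e) → V10 B = V00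 B * expPt m → (∀ e, e ≠ B' → V01 e = V00 e) → V01 B' = V00 B' * expPt m' → (∀ e, e ≠ B' → V11 e = V10 e) → V11 B' = V10 B' * expPt m' → ∀ (Y : ℝ → GaugeField (F.P j) 0 ↥(Matrix.specialUnitaryGroup (Fin 2) ℂ)) (X : ℝ → ℝ → GaugeField (F.P j) 0 ↥(Matrix.specialUnitaryGroup (Fin 2) ℂ)), (∀ s e, e ≠ B → Y s e = V00 e) → (∀ s, Y s B = V00 B * expPt (s • m)) → (∀ s s' e, e ≠ B' → X s s' e = Y s e) → (∀ s s', X s s' B' = Y s B' * expPt (s' • m')) →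
          ∃ (w₁ : ℝ → ℝ → Z → ℝ) (b bF : Z → ℝ), Integrable b τ ∧ Integrable bF τ ∧ (∀ s s', AEStronglyMeasurable (w₁ s s') τ) ∧
            (∀ s' ∈ Set.Icc (0:ℝ) 1, ∀ᵐ z ∂τ, LipschitzOnWith (Real.nnabs (b z)) (fun s => wNum F γ b₀ p₀ j Ts ρ ρ' Φ J t (X s s') z) (Set.Ioo (-1) 2)) ∧
            (∀ s' ∈ Set.Icc (0:ℝ) 1, ∀ᵐ z ∂τ, LipschitzOnWith (Real.nnabs (bF z)) (fun s => (Real.log (ρ Ts (Φ (V00, z))) - Real.log (ρ' Ts (Φ (V00, z)))) * wNum F γ b₀ p₀ j Ts ρ ρ' Φ J t (X s s') z) (Set.Ioo (-1) 2)) ∧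
            (∀ s ∈ Set.Icc (0:ℝ) 1, ∀ s' ∈ Set.Icc (0:ℝ) 1, ∀ᵐ z ∂τ, HasDerivAt (fun s => wNum F γ b₀ p₀ j Ts ρ ρ' Φ J t (X s s') z) (w₁ s s' z) s) ∧
            (∀ s ∈ Set.Icc (0:ℝ) 1, |((∫ z, (Real.log (ρ Ts (Φ (V00, z))) - Real.log (ρ' Ts (Φ (V00, z)))) * (w₁ s 1 z / wNum F γ b₀ p₀ j Ts ρ ρ' Φ J t (X s 1) z) * (wNum F γ b₀ p₀ j Ts ρ ρ' Φ J t (X s 1) z / ∫ z', wNum F γ b₀ p₀ j Ts ρ ρ' Φ J t (X s 1) z' ∂τ) ∂τ)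
                  - (∫ z, (Real.log (ρ Ts (Φ (V00, z))) - Real.log (ρ' Ts (Φ (V00, z)))) * (wNum F γ b₀ p₀ j Ts ρ ρ' Φ J t (X s 1) z / ∫ z', wNum F γ b₀ p₀ j Ts ρ ρ' Φ J t (X s 1) z' ∂τ) ∂τ) * (∫ z, (w₁ s 1 z / wNum F γ b₀ p₀ j Ts ρ ρ' Φ J t (X s 1) z) * (wNum F γ b₀ p₀ j Ts ρ ρ' Φ J t (X s 1) z / ∫ z', wNum F γ b₀ p₀ j Ts ρ ρ' Φ J t (X s 1) z' ∂τ) ∂τ))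
                - ((∫ z, (Real.log (ρ Ts (Φ (V00, z))) - Real.log (ρ' Ts (Φ (V00, z)))) * (w₁ s 0 z / wNum F γ b₀ p₀ j Ts ρ ρ' Φ J t (X s 0) z) * (wNum F γ b₀ p₀ j Ts ρ ρ' Φ J t (X s 0) z / ∫ z', wNum F γ b₀ p₀ j Ts ρ ρ' Φ J t (X s 0) z' ∂τ) ∂τ)
                  - (∫ z, (Real.log (ρ Ts (Φ (V00, z))) - Real.log (ρ' Ts (Φ (V00, z)))) * (wNum F γ b₀ p₀ j Ts ρ ρ' Φ J t (X s 0) z / ∫ z', wNum F γ b₀ p₀ j Ts ρ ρ' Φ J t (X s 0) z' ∂τ) ∂τ) * (∫ z, (w₁ s 0 z / wNum F γ b₀ p₀ j Ts ρ ρ' Φ J t (X s 0) z) * (wNum F γ b₀ p₀ j Ts ρ ρ' Φ J t (X s 0) z / ∫ z', wNum F γ b₀ p₀ j Ts ρ ρ' Φ J t (X s 0) z' ∂τ) ∂τ))| ≤ kL B B' * (‖m‖ / (θBal F.L γ b₀ p₀ j / 4)) * (‖m'‖ / (θBal F.L γ b₀ p₀ j / 4)))))) ∧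
    (∃ kV₃ : PBond (F.P j) 0 → PBond (F.P j) 0 → ℝ, (∀ B B', 0 ≤ kV₃ B B') ∧ (∀ B, ∑ B', kV₃ B B' * Real.exp (κ * (B.src.tdist B'.src : ℝ)) ≤ NV3 * ((((F.L : ℝ) ^ j / γ) * θBal F.L γ b₀ p₀ j ^ 2) / (((F.L : ℝ) ^ Ts / γ) * θBal F.L γ b₀ p₀ Ts ^ 2)) * w * (w / (((F.L : ℝ) ^ Ts / γ) * θBal F.L γ b₀ p₀ Ts ^ 2)) + δV3 j * (((F.L : ℝ) ^ j / γ) * θBal F.L γ b₀ p₀ j ^ 2)) ∧ (∀ B', ∑ B, kV₃ B B' * Real.exp (κ * (B.src.tdist B'.src : ℝ)) ≤ NV3 * ((((F.L : ℝ) ^ j / γ) * θBal F.L γ b₀ p₀ j ^ 2) / (((F.L : ℝ) ^ Ts / γ) * θBal F.L γ b₀ p₀ Ts ^ 2)) * w * (w / (((F.L : ℝ) ^ Ts / γ) * θBal F.L γ b₀ p₀ Ts ^ 2)) + δV3 j * (((F.L : ℝ) ^ j / γ) * θBal F.L γ b₀ p₀ j ^ 2)) ∧ ∀ t : ℝ,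 0 ≤ t → t ≤ 1 → (∀ (B B' : PBond (F.P j) 0) (m m' : Fin 3 → ℝ) (U₁ V₁ W₂ : GaugeField (F.P j) 0 ↥(Matrix.specialUnitaryGroup (Fin 2) ℂ)), ‖m‖ ≤ rc * (θBal F.L γ b₀ p₀ j / 4) → ‖m'‖ ≤ rc * (θBal F.L γ b₀ p₀ j / 4) → PlaqSmall (θBal F.L γ b₀ p₀ j / 4) U₁ → PlaqSmall (θBal F.L γ b₀ p₀ j / 4) V₁ → PlaqSmall (θBal F.L γ b₀ p₀ j / 4) W₂ → (∀ e, e ≠ B → V₁ e = U₁ e) → V₁ B = U₁ B * expPt m → (∀ e, e ≠ B' → W₂ e = V₁ e) → W₂ B' = V₁ B' * expPt m' → ∀ (X : ℝ → GaugeField (F.P j) 0 ↥(Matrix.specialUnitaryGroup (Fin 2) ℂ)), (∀ s e, e ≠ B' → X s e = V₁ e) → (∀ s, X s B' = V₁ B' * expPt (s • m')) →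
            ∃ (wN' : ℝ → Z → ℝ) (b bD bS bDS : Z → ℝ), Integrable b τ ∧ Integrable bD τ ∧ Integrable bS τ ∧ Integrable bDS τ ∧ (∀ s, AEStronglyMeasurable (wN' s) τ) ∧
              (∀ᵐ z ∂τ, LipschitzOnWith (Real.nnabs (b z)) (fun s => wNum F γ b₀ p₀ j Ts ρ ρ' Φ J t (X s) z) (Set.Ioo (-1) 2)) ∧
              (∀ᵐ z ∂τ, LipschitzOnWith (Real.nnabs (bD z)) (fun s => ((Real.log (ρ Ts (Φ (V₁, z))) - Real.log (ρ' Ts (Φ (V₁, z)))) - (Real.log (ρ Ts (Φ (U₁, z))) - Real.log (ρ' Ts (Φ (U₁, z))))) * wNum F γ b₀ p₀ j Ts ρ ρ' Φ J t (X s) z) (Set.Ioo (-1) 2)) ∧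
              (∀ᵐ z ∂τ, LipschitzOnWith (Real.nnabs (bS z)) (fun s => ((Real.log (ρ Ts (Φ (V₁, z))) - Real.log (ρ' Ts (Φ (V₁, z)))) + (Real.log (ρ Ts (Φ (U₁, z))) - Real.log (ρ' Ts (Φ (U₁, z))))) * wNum F γ b₀ p₀ j Ts ρ ρ' Φ J t (X s) z) (Set.Ioo (-1) 2)) ∧
              (∀ᵐ z ∂τ, LipschitzOnWith (Real.nnabs (bDS z)) (fun s => (((Real.log (ρ Ts (Φ (V₁, z))) - Real.log (ρ' Ts (Φ (V₁, z)))) - (Real.log (ρ Ts (Φ (U₁, z))) - Real.log (ρ' Ts (Φ (U₁, z))))) * ((Real.log (ρ Ts (Φ (V₁, z))) - Real.log (ρ' Ts (Φ (V₁, z)))) + (Real.log (ρ Ts (Φ (U₁, z))) - Real.log (ρ' Ts (Φ (U₁, z)))))) * wNum F γ b₀ p₀ j Ts ρ ρ' Φ J t (X s) z) (Set.Ioo (-1) 2)) ∧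
              (∀ s ∈ Set.Icc (0:ℝ) 1, ∀ᵐ z ∂τ, HasDerivAt (fun s => wNum F γ b₀ p₀ j Ts ρ ρ' Φ J t (X s) z) (wN' s z) s) ∧
              (∀ s ∈ Set.Icc (0:ℝ) 1, |(((∫ z, (((Real.log (ρ Ts (Φ (V₁, z))) - Real.log (ρ' Ts (Φ (V₁, z)))) - (Real.log (ρ Ts (Φ (U₁, z))) - Real.log (ρ' Ts (Φ (U₁, z))))) * ((Real.log (ρ Ts (Φ (V₁, z))) - Real.log (ρ' Ts (Φ (V₁, z)))) + (Real.log (ρ Ts (Φ (U₁, z))) - Real.log (ρ' Ts (Φ (U₁, z)))))) * (wN' s z / wNum F γ b₀ p₀ j Ts ρ ρ' Φ J t (X s) z) * (wNum F γ b₀ p₀ j Ts ρ ρ' Φ J t (X s) z / ∫ z', wNum F γ b₀ p₀ j Ts ρ ρ' Φ J t (X s) z' ∂τ) ∂τ)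
                  - (∫ z, (((Real.log (ρ Ts (Φ (V₁, z))) - Real.log (ρ' Ts (Φ (V₁, z)))) - (Real.log (ρ Ts (Φ (U₁, z))) - Real.log (ρ' Ts (Φ (U₁, z))))) * ((Real.log (ρ Ts (Φ (V₁, z))) - Real.log (ρ' Ts (Φ (V₁, z)))) + (Real.log (ρ Ts (Φ (U₁, z))) - Real.log (ρ' Ts (Φ (U₁, z)))))) * (wNum F γ b₀ p₀ j Ts ρ ρ' Φ J t (X s) z / ∫ z', wNum F γ b₀ p₀ j Ts ρ ρ' Φ J t (X s) z' ∂τ) ∂τ) * (∫ z, (wN' s z / wNum F γ b₀ p₀ j Ts ρ ρ' Φ J t (X s) z) * (wNum F γ b₀ p₀ j Ts ρ ρ' Φ J t (X s) z / ∫ z', wNum F γ b₀ p₀ j Ts ρ ρ' Φ J t (X s) z' ∂τ) ∂τ))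
                - (((∫ z, ((Real.log (ρ Ts (Φ (V₁, z))) - Real.log (ρ' Ts (Φ (V₁, z)))) - (Real.log (ρ Ts (Φ (U₁, z))) - Real.log (ρ' Ts (Φ (U₁, z))))) * (wN' s z / wNum F γ b₀ p₀ j Ts ρ ρ' Φ J t (X s) z) * (wNum F γ b₀ p₀ j Ts ρ ρ' Φ J t (X s) z / ∫ z', wNum F γ b₀ p₀ j Ts ρ ρ' Φ J t (X s) z' ∂τ) ∂τ)
                      - (∫ z, ((Real.log (ρ Ts (Φ (V₁, z))) - Real.log (ρ' Ts (Φ (V₁, z)))) - (Real.log (ρ Ts (Φ (U₁, z))) - Real.log (ρ' Ts (Φ (U₁, z))))) * (wNum F γ b₀ p₀ j Ts ρ ρ' Φ J t (X s) z / ∫ z', wNum F γ b₀ p₀ j Ts ρ ρ' Φ J t (X s) z' ∂τ) ∂τ) * (∫ z, (wN' s z / wNum F γ b₀ p₀ j Ts ρ ρ' Φ J t (X s) z) * (wNum F γ b₀ p₀ j Ts ρ ρ' Φ J t (X s) z / ∫ z', wNum F γ b₀ p₀ j Ts ρ ρ' Φ J t (X s) z' ∂τ) ∂τ))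
                    * (∫ z, ((Real.log (ρ Ts (Φ (V₁, z))) - Real.log (ρ' Ts (Φ (V₁, z)))) + (Real.log (ρ Ts (Φ (U₁, z))) - Real.log (ρ' Ts (Φ (U₁, z))))) * (wNum F γ b₀ p₀ j Ts ρ ρ' Φ J t (X s) z / ∫ z', wNum F γ b₀ p₀ j Ts ρ ρ' Φ J t (X s) z' ∂τ) ∂τ)
                  + (∫ z, ((Real.log (ρ Ts (Φ (V₁, z))) - Real.log (ρ' Ts (Φ (V₁, z)))) - (Real.log (ρ Ts (Φ (U₁, z))) - Real.log (ρ' Ts (Φ (U₁, z))))) * (wNum F γ b₀ p₀ j Ts ρ ρ' Φ J t (X s) z / ∫ z', wNum F γ b₀ p₀ j Ts ρ ρ' Φ J t (X s) z' ∂τ) ∂τ)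
                    * ((∫ z, ((Real.log (ρ Ts (Φ (V₁, z))) - Real.log (ρ' Ts (Φ (V₁, z)))) + (Real.log (ρ Ts (Φ (U₁, z))) - Real.log (ρ' Ts (Φ (U₁, z))))) * (wN' s z / wNum F γ b₀ p₀ j Ts ρ ρ' Φ J t (X s) z) * (wNum F γ b₀ p₀ j Ts ρ ρ' Φ J t (X s) z / ∫ z', wNum F γ b₀ p₀ j Ts ρ ρ' Φ J t (X s) z' ∂τ) ∂τ)
                      - (∫ z, ((Real.log (ρ Ts (Φ (V₁, z))) - Real.log (ρ' Ts (Φ (V₁, z)))) + (Real.log (ρ Ts (Φ (U₁, z))) - Real.log (ρ' Ts (Φ (U₁, z))))) * (wNum F γ b₀ p₀ j Ts ρ ρ' Φ J t (X s) z / ∫ z', wNum F γ b₀ p₀ j Ts ρ ρ' Φ J t (X s) z' ∂τ) ∂τ) * (∫ z, (wN' s z / wNum F γ b₀ p₀ j Ts ρ ρ' Φ J t (X s) z) * (wNum F γ b₀ p₀ j Ts ρ ρ' Φ J t (X s) z / ∫ z', wNum F γ b₀ p₀ j Ts ρ ρ' Φ J t (X s) z' ∂τ) ∂τ))))| ≤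 kV₃ B B' * (‖m‖ / (θBal F.L γ b₀ p₀ j / 4)) * (‖m'‖ / (θBal F.L γ b₀ p₀ j / 4))))) ∧
    (∃ kV₄ : PBond (F.P j) 0 → PBond (F.P j) 0 → ℝ, (∀ B B', 0 ≤ kV₄ B B') ∧ (∀ B, ∑ B', kV₄ B B' * Real.exp (κ * (B.src.tdist B'.src : ℝ)) ≤ NV4 * ((((F.L : ℝ) ^ j / γ) * θBal F.L γ b₀ p₀ j ^ 2) / (((F.L : ℝ) ^ Ts / γ) * θBal F.L γ b₀ p₀ Ts ^ 2)) * w * (w / (((F.L : ℝ) ^ Ts / γ) * θBal F.L γ b₀ p₀ Ts ^ 2)) + δV4 j * (((F.L : ℝ) ^ j / γ) * θBal F.L γ b₀ p₀ j ^ 2)) ∧ ∀ t : ℝ, 0 ≤ t → t ≤ 1 → (∀ (B B' : PBond (F.P j) 0) (m m' : Fin 3 → ℝ) (V00 V10 V01 V11 : GaugeField (F.P j) 0 ↥(Matrix.specialUnitaryGroup (Fin 2) ℂ)), ‖m‖ ≤ rc * (θBal F.L γ b₀ p₀ j / 4) → ‖m'‖ ≤ rc * (θBal F.L γ b₀ p₀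 j / 4) → PlaqSmall (θBal F.L γ b₀ p₀ j / 4) V00 → PlaqSmall (θBal F.L γ b₀ p₀ j / 4) V10 → PlaqSmall (θBal F.L γ b₀ p₀ j / 4) V01 → PlaqSmall (θBal F.L γ b₀ p₀ j / 4) V11 → (∀ e, e ≠ B → V10 e = V00 e) → V10 B = V00 B * expPt m → (∀ e, e ≠ B' → V01 e = V00 e) → V01 B' = V00 B' * expPt m' → (∀ e, e ≠ B' → V11 e = V10 e) → V11 B' = V10 B' * expPt m' → ∀ (Y : ℝ → GaugeField (F.P j) 0 ↥(Matrix.specialUnitaryGroup (Fin 2) ℂ)) (X : ℝ → ℝ → GaugeField (F.P j) 0 ↥(Matrix.specialUnitaryGroup (Fin 2) ℂ)), (∀ s e, e ≠ B → Y s e = V00 e) → (∀ s, Y s B = V00 B * expPt (s • m)) → (∀ s s' e, e ≠ B' → X s s' e = Y s e) → (∀ s s', X s s' B' = Y s B' * expPt (s' • m')) →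
            ∃ (w₁ : ℝ → ℝ → Z → ℝ) (b bF bFF : Z → ℝ), Integrable b τ ∧ Integrable bF τ ∧ Integrable bFF τ ∧ (∀ s s', AEStronglyMeasurable (w₁ s s') τ) ∧
              (∀ s' ∈ Set.Icc (0:ℝ) 1, ∀ᵐ z ∂τ, LipschitzOnWith (Real.nnabs (b z)) (fun s => wNum F γ b₀ p₀ j Ts ρ ρ' Φ J t (X s s') z) (Set.Ioo (-1) 2)) ∧
              (∀ s' ∈ Set.Icc (0:ℝ) 1, ∀ᵐ z ∂τ, LipschitzOnWith (Real.nnabs (bF z)) (fun s => (Real.log (ρ Ts (Φ (V00, z))) - Real.log (ρ' Ts (Φ (V00, z)))) * wNum F γ b₀ p₀ j Ts ρ ρ' Φ J t (X s s') z) (Set.Ioo (-1) 2)) ∧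
              (∀ s' ∈ Set.Icc (0:ℝ) 1, ∀ᵐ z ∂τ, LipschitzOnWith (Real.nnabs (bFF z)) (fun s => ((Real.log (ρ Ts (Φ (V00, z))) - Real.log (ρ' Ts (Φ (V00, z)))) * (Real.log (ρ Ts (Φ (V00, z))) - Real.log (ρ' Ts (Φ (V00, z))))) * wNum F γ b₀ p₀ j Ts ρ ρ' Φ J t (X s s') z) (Set.Ioo (-1) 2)) ∧
              (∀ s ∈ Set.Icc (0:ℝ) 1, ∀ s' ∈ Set.Icc (0:ℝ) 1, ∀ᵐ z ∂τ, HasDerivAt (fun s => wNum F γ b₀ p₀ j Ts ρ ρ' Φ J t (X s s') z) (w₁ s s' z) s) ∧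
              (∀ s ∈ Set.Icc (0:ℝ) 1, |(((∫ z, ((Real.log (ρ Ts (Φ (V00, z))) - Real.log (ρ' Ts (Φ (V00, z)))) * (Real.log (ρ Ts (Φ (V00, z))) - Real.log (ρ' Ts (Φ (V00, z))))) * (w₁ s 1 z / wNum F γ b₀ p₀ j Ts ρ ρ' Φ J t (X s 1) z) * (wNum F γ b₀ p₀ j Ts ρ ρ' Φ J t (X s 1) z / ∫ z', wNum F γ b₀ p₀ j Ts ρ ρ' Φ J t (X s 1) z' ∂τ) ∂τ) - (∫ z, ((Real.log (ρ Ts (Φ (V00, z))) - Real.log (ρ' Ts (Φ (V00, z)))) * (Real.log (ρ Ts (Φ (V00, z))) - Real.log (ρ' Ts (Φ (V00, z))))) * (wNum F γ b₀ p₀ j Ts ρ ρ' Φ J t (X s 1) z / ∫ z', wNum F γ b₀ p₀ j Ts ρ ρ' Φ J t (X s 1) z' ∂τ) ∂τ) * (∫ z, (w₁ s 1 z / wNum F γ b₀ p₀ j Ts ρ ρ' Φ J t (X s 1) z) * (wNum F γ b₀ p₀ j Ts ρ ρ' Φ J t (X s 1) z / ∫ z', wNum F γ b₀ p₀ j Ts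 ρ ρ' Φ J t (X s 1) z' ∂τ) ∂τ))
                  - (((∫ z, (Real.log (ρ Ts (Φ (V00, z))) - Real.log (ρ' Ts (Φ (V00, z)))) * (w₁ s 1 z / wNum F γ b₀ p₀ j Ts ρ ρ' Φ J t (X s 1) z) * (wNum F γ b₀ p₀ j Ts ρ ρ' Φ J t (X s 1) z / ∫ z', wNum F γ b₀ p₀ j Ts ρ ρ' Φ J t (X s 1) z' ∂τ) ∂τ) - (∫ z, (Real.log (ρ Ts (Φ (V00, z))) - Real.log (ρ' Ts (Φ (V00, z)))) * (wNum F γ b₀ p₀ j Ts ρ ρ' Φ J t (X s 1) z / ∫ z', wNum F γ b₀ p₀ j Ts ρ ρ' Φ J t (X s 1) z' ∂τ) ∂τ) * (∫ z, (w₁ s 1 z / wNum F γ b₀ p₀ j Ts ρ ρ' Φ J t (X s 1) z) * (wNum F γ b₀ p₀ j Ts ρ ρ' Φ J t (X s 1) z / ∫ z', wNum F γ b₀ p₀ j Ts ρ ρ' Φ J t (X s 1) z' ∂τ) ∂τ)) * (∫ z, (Real.log (ρ Ts (Φ (V00, z))) - Real.log (ρ' Ts (Φ (V00, z)))) * (wNum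 F γ b₀ p₀ j Ts ρ ρ' Φ J t (X s 1) z / ∫ z', wNum F γ b₀ p₀ j Ts ρ ρ' Φ J t (X s 1) z' ∂τ) ∂τ)
                    + (∫ z, (Real.log (ρ Ts (Φ (V00, z))) - Real.log (ρ' Ts (Φ (V00, z)))) * (wNum F γ b₀ p₀ j Ts ρ ρ' Φ J t (X s 1) z / ∫ z', wNum F γ b₀ p₀ j Ts ρ ρ' Φ J t (X s 1) z' ∂τ) ∂τ) * ((∫ z, (Real.log (ρ Ts (Φ (V00, z))) - Real.log (ρ' Ts (Φ (V00, z)))) * (w₁ s 1 z / wNum F γ b₀ p₀ j Ts ρ ρ' Φ J t (X s 1) z) * (wNum F γ b₀ p₀ j Ts ρ ρ' Φ J t (X s 1) z / ∫ z', wNum F γ b₀ p₀ j Ts ρ ρ' Φ J t (X s 1) z' ∂τ) ∂τ) - (∫ z, (Real.log (ρ Ts (Φ (V00, z))) - Real.log (ρ' Ts (Φ (V00, z)))) * (wNum F γ b₀ p₀ j Ts ρ ρ' Φ J t (X s 1) z / ∫ z', wNum F γ b₀ p₀ j Ts ρ ρ' Φ J t (X s 1) z' ∂τ) ∂τ) *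 (∫ z, (w₁ s 1 z / wNum F γ b₀ p₀ j Ts ρ ρ' Φ J t (X s 1) z) * (wNum F γ b₀ p₀ j Ts ρ ρ' Φ J t (X s 1) z / ∫ z', wNum F γ b₀ p₀ j Ts ρ ρ' Φ J t (X s 1) z' ∂τ) ∂τ))))
                - (((∫ z, ((Real.log (ρ Ts (Φ (V00, z))) - Real.log (ρ' Ts (Φ (V00, z)))) * (Real.log (ρ Ts (Φ (V00, z))) - Real.log (ρ' Ts (Φ (V00, z))))) * (w₁ s 0 z / wNum F γ b₀ p₀ j Ts ρ ρ' Φ J t (X s 0) z) * (wNum F γ b₀ p₀ j Ts ρ ρ' Φ J t (X s 0) z / ∫ z', wNum F γ b₀ p₀ j Ts ρ ρ' Φ J t (X s 0) z' ∂τ) ∂τ) - (∫ z, ((Real.log (ρ Ts (Φ (V00, z))) - Real.log (ρ' Ts (Φ (V00, z)))) * (Real.log (ρ Ts (Φ (V00, z))) - Real.log (ρ' Ts (Φ (V00, z))))) * (wNum F γ b₀ p₀ j Ts ρ ρ' Φ J t (X s 0) z / ∫ z', wNum F γ b₀ p₀ j Ts ρ ρ' Φ J t (X s 0) z' ∂τ)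 ∂τ) * (∫ z, (w₁ s 0 z / wNum F γ b₀ p₀ j Ts ρ ρ' Φ J t (X s 0) z) * (wNum F γ b₀ p₀ j Ts ρ ρ' Φ J t (X s 0) z / ∫ z', wNum F γ b₀ p₀ j Ts ρ ρ' Φ J t (X s 0) z' ∂τ) ∂τ))
                  - (((∫ z, (Real.log (ρ Ts (Φ (V00, z))) - Real.log (ρ' Ts (Φ (V00, z)))) * (w₁ s 0 z / wNum F γ b₀ p₀ j Ts ρ ρ' Φ J t (X s 0) z) * (wNum F γ b₀ p₀ j Ts ρ ρ' Φ J t (X s 0) z / ∫ z', wNum F γ b₀ p₀ j Ts ρ ρ' Φ J t (X s 0) z' ∂τ) ∂τ) - (∫ z, (Real.log (ρ Ts (Φ (V00, z))) - Real.log (ρ' Ts (Φ (V00, z)))) * (wNum F γ b₀ p₀ j Ts ρ ρ' Φ J t (X s 0) z / ∫ z', wNum F γ b₀ p₀ j Ts ρ ρ' Φ J t (X s 0) z' ∂τ) ∂τ) * (∫ z, (w₁ s 0 z / wNum F γ b₀ p₀ j Ts ρ ρ' Φ J t (X s 0) z) * (wNum F γ b₀ p₀ j Ts ρ ρ' Φ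 J t (X s 0) z / ∫ z', wNum F γ b₀ p₀ j Ts ρ ρ' Φ J t (X s 0) z' ∂τ) ∂τ)) * (∫ z, (Real.log (ρ Ts (Φ (V00, z))) - Real.log (ρ' Ts (Φ (V00, z)))) * (wNum F γ b₀ p₀ j Ts ρ ρ' Φ J t (X s 0) z / ∫ z', wNum F γ b₀ p₀ j Ts ρ ρ' Φ J t (X s 0) z' ∂τ) ∂τ)
                    + (∫ z, (Real.log (ρ Ts (Φ (V00, z))) - Real.log (ρ' Ts (Φ (V00, z)))) * (wNum F γ b₀ p₀ j Ts ρ ρ' Φ J t (X s 0) z / ∫ z', wNum F γ b₀ p₀ j Ts ρ ρ' Φ J t (X s 0) z' ∂τ) ∂τ) * ((∫ z, (Real.log (ρ Ts (Φ (V00, z))) - Real.log (ρ' Ts (Φ (V00, z)))) * (w₁ s 0 z / wNum F γ b₀ p₀ j Ts ρ ρ' Φ J t (X s 0) z) * (wNum F γ b₀ p₀ j Ts ρ ρ' Φ J t (X s 0) z / ∫ z', wNum F γ b₀ p₀ j Ts ρ ρ' Φ J t (X s 0) z' ∂τ) ∂τ) - (∫ z, (Real.log (ρ Ts (Φ (V00,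 z))) - Real.log (ρ' Ts (Φ (V00, z)))) * (wNum F γ b₀ p₀ j Ts ρ ρ' Φ J t (X s 0) z / ∫ z', wNum F γ b₀ p₀ j Ts ρ ρ' Φ J t (X s 0) z' ∂τ) ∂τ) * (∫ z, (w₁ s 0 z / wNum F γ b₀ p₀ j Ts ρ ρ' Φ J t (X s 0) z) * (wNum F γ b₀ p₀ j Ts ρ ρ' Φ J t (X s 0) z / ∫ z', wNum F γ b₀ p₀ j Ts ρ ρ' Φ J t (X s 0) z' ∂τ) ∂τ))))| ≤ kV₄ B B' * (‖m‖ / (θBal F.L γ b₀ p₀ j / 4)) * (‖m'‖ / (θBal F.L γ b₀ p₀ j / 4))))) ∧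
    ((∃ (Prof : GaugeField (F.P j) 0 ↥(Matrix.specialUnitaryGroup (Fin 2) ℂ) → (Z → ℝ) → (Plaq (F.P Ts) 0 → ℝ) → Prop) (𝒢 ωf : Plaq (F.P Ts) 0 → Plaq (F.P Ts) 0 → ℝ) (NG NG₀ : ℝ) (K ωX : Plaq (F.P Ts) 0 → PBond (F.P j) 0 → ℝ) (Ncol Nrow : ℝ) (K2 : Plaq (F.P Ts) 0 → PBond (F.P j) 0 → PBond (F.P j) 0 → ℝ) (NY x₀ : ℝ), (∀ a c, 0 ≤ 𝒢 a c) ∧ (∀ a c, 0 ≤ ωf a c) ∧ 0 ≤ NG ∧ (∀ a, ∑ c, 𝒢 a c * ωf a c ≤ NG) ∧ 0 ≤ NG₀ ∧ (∀ a, ∑ c, 𝒢 a c ≤ NG₀) ∧ (∀ t : ℝ, 0 ≤ t → t ≤ 1 → ∀ Xw : GaugeField (F.P j) 0 ↥(Matrix.specialUnitaryGroup (Fin 2) ℂ), PlaqSmall (θBal F.L γ b₀ p₀ j / 4) Xw → ∀ (Pf Qf : Z → ℝ) (p q : Plaq (F.P Ts) 0 → ℝ), Prof Xw Pf p → Prof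 Xw Qf q → ∀ (cP cQ : ℝ), cP = ∫ z, Pf z * (wgt F γ b₀ p₀ j Ts ρ ρ' τ Φ J t) Xw z ∂τ → cQ = ∫ z, Qf z * (wgt F γ b₀ p₀ j Ts ρ ρ' τ Φ J t) Xw z ∂τ → Integrable (fun z => (Pf z - cP) * (Qf z - cQ) * (wgt F γ b₀ p₀ j Ts ρ ρ' τ Φ J t) Xw z) τ ∧ |∫ z, (Pf z - cP) * (Qf z - cQ) * (wgt F γ b₀ p₀ j Ts ρ ρ' τ Φ J t) Xw z ∂τ| ≤ ∑ a, ∑ c, |p a| * 𝒢 a c * |q c|) ∧ (∀ a B, 0 ≤ K a B) ∧ (∀ a B, 0 ≤ ωX a B) ∧ 0 ≤ Nrow ∧ (∀ B, ∑ a, K a B * ωX a B ≤ Ncol) ∧ (∀ c, ∑ B', K c B' * ωX c B' ≤ Nrow) ∧ (∀ (B B' : PBond (F.P j) 0) (a c : Plaq (F.P Ts) 0), Real.exp (κ * (B.src.tdist B'.src : ℝ)) ≤ ωX a B * ωf a c * ωX c B') ∧ (∀ (B B' : PBond (F.P j) 0) (m m' : Fin 3 → ℝ) (U V W Y : GaugeField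 (F.P j) 0 ↥(Matrix.specialUnitaryGroup (Fin 2) ℂ)), ‖m‖ ≤ rc * (θBal F.L γ b₀ p₀ j / 4) → ‖m'‖ ≤ rc * (θBal F.L γ b₀ p₀ j / 4) → PlaqSmall (θBal F.L γ b₀ p₀ j / 4) U → PlaqSmall (θBal F.L γ b₀ p₀ j / 4) V → PlaqSmall (θBal F.L γ b₀ p₀ j / 4) W → PlaqSmall (θBal F.L γ b₀ p₀ j / 4) Y → (∀ e, e ≠ B → V e = U e) → V B = U B * expPt m → (∀ e, e ≠ B' → W e = U e) → W B' = U B' * expPt m' → (∀ e, e ≠ B' → Y e = V e) → Y B' = V B' * expPt m' → Prof Y (fun z => (Real.log (ρ Ts (Φ (V, z))) - Real.log (ρ' Ts (Φ (V, z)))) - (Real.log (ρ Ts (Φ (U, z))) - Real.log (ρ' Ts (Φ (U, z))))) (fun a => ‖m‖ / (θBal F.L γ b₀ p₀ j / 4) * K a B) ∧ Prof Y (fun z => (Real.log (ρ Ts (Φ (W, z))) - Real.log (ρ' Ts (Φ (W, z)))) - (Real.log (ρ Ts (Φ (U, z))) - Real.log (ρ' Ts (Φ (U, z))))) (fun a =>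 ‖m'‖ / (θBal F.L γ b₀ p₀ j / 4) * K a B')) ∧ (∀ a B B', 0 ≤ K2 a B B') ∧ (∀ B, ∑ a, ∑ B', K2 a B B' * Real.exp (κ * (B.src.tdist B'.src : ℝ)) ≤ NY) ∧ (∀ (B B' : PBond (F.P j) 0) (m m' : Fin 3 → ℝ) (U V W Y : GaugeField (F.P j) 0 ↥(Matrix.specialUnitaryGroup (Fin 2) ℂ)), ‖m‖ ≤ rc * (θBal F.L γ b₀ p₀ j / 4) → ‖m'‖ ≤ rc * (θBal F.L γ b₀ p₀ j / 4) → PlaqSmall (θBal F.L γ b₀ p₀ j / 4) U → PlaqSmall (θBal F.L γ b₀ p₀ j / 4) V → PlaqSmall (θBal F.L γ b₀ p₀ j / 4) W → PlaqSmall (θBal F.L γ b₀ p₀ j / 4) Y → (∀ e, e ≠ B → V e = U e) → V B = U B * expPt m → (∀ e, e ≠ B' → W e = U e) → W B' = U B' * expPt m' → (∀ e, e ≠ B' → Y e = V e) → Y B' = V B' * expPt m' → Prof Y (fun z => (Real.log (ρ Ts (Φ (Y, z))) - Real.log (ρ' Ts (Φ (Y, z)))) - (Real.log (ρ Ts (Φ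 (V, z))) - Real.log (ρ' Ts (Φ (V, z)))) - (Real.log (ρ Ts (Φ (W, z))) - Real.log (ρ' Ts (Φ (W, z)))) + (Real.log (ρ Ts (Φ (U, z))) - Real.log (ρ' Ts (Φ (U, z))))) (fun a => ‖m‖ / (θBal F.L γ b₀ p₀ j / 4) * (‖m'‖ / (θBal F.L γ b₀ p₀ j / 4)) * K2 a B B')) ∧ 0 ≤ x₀ ∧ (∀ (B B' : PBond (F.P j) 0) (m m' : Fin 3 → ℝ) (U V W Y X : GaugeField (F.P j) 0 ↥(Matrix.specialUnitaryGroup (Fin 2) ℂ)), ‖m‖ ≤ rc * (θBal F.L γ b₀ p₀ j / 4) → ‖m'‖ ≤ rc * (θBal F.L γ b₀ p₀ j / 4) → PlaqSmall (θBal F.L γ b₀ p₀ j / 4) U → PlaqSmall (θBal F.L γ b₀ p₀ j / 4) V → PlaqSmall (θBal F.L γ b₀ p₀ j / 4) W → PlaqSmall (θBal F.L γ b₀ p₀ j / 4) Y → PlaqSmall (θBal F.L γ b₀ p₀ j / 4) X → (X = U ∨ X = V ∨ X = W ∨ X = Y) → (∀ e, e ≠ B → V e = U e) → V B = U B * expPt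 m → (∀ e, e ≠ B' → W e = U e) → W B' = U B' * expPt m' → (∀ e, e ≠ B' → Y e = V e) → Y B' = V B' * expPt m' → Prof Y (fun z => (Real.log (ρ Ts (Φ (X, z))) - Real.log (ρ' Ts (Φ (X, z))))) (fun _ => x₀)) ∧ Ncol * NG * Nrow ≤ (NV2 * ((((F.L : ℝ) ^ j / γ) * θBal F.L γ b₀ p₀ j ^ 2) / (((F.L : ℝ) ^ Ts / γ) * θBal F.L γ b₀ p₀ Ts ^ 2)) * w * (w / (((F.L : ℝ) ^ Ts / γ) * θBal F.L γ b₀ p₀ Ts ^ 2)) + δV2 j * (((F.L : ℝ) ^ j / γ) * θBal F.L γ b₀ p₀ j ^ 2)) ∧ x₀ * NG₀ * NY ≤ (NV1 * ((((F.L : ℝ) ^ j / γ) * θBal F.L γ b₀ p₀ j ^ 2) / (((F.L : ℝ) ^ Ts / γ) * θBal F.L γ b₀ p₀ Ts ^ 2)) * w * (w / (((F.L : ℝ) ^ Ts / γ) * θBal F.L γ b₀ p₀ Ts ^ 2)) + δV1 j * (((F.L : ℝ) ^ j / γ) * θBal F.L γ b₀ p₀ j ^ 2)))))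

end Summit.QuantumFields.YangMills.Theorems.FluctuationComparisonRegPrIntLRunpairOrganDischargeInputsHJsq

end
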